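import Literature.MathematicalPhysics.QuantumLattice.TorusWilsonLinkTranslations
import Literature.MathematicalPhysics.QuantumLattice.LatticeGaugeDLRFreeEnergyProofs
import Literature.MathematicalPhysics.QuantumLattice.ContinuumLimitLGT
import Summits.QuantumFields.YangMills.Theorems.SoloBlindStrongCouplingRung
import HarnessLib

/-!
# A volume-uniform variance floor for local observables (solo-QuantumFields-blind, rung D10)

## One link, one Haar average

Rung D9 (`SoloBlindNoUniformRate`) typed the IR-0 skeleton of the accompanying paper
(`paper/local-gaussianity.md`, Theorem B): on the statement's odd tori `(ℤ/(2S+1))⁴` a VARIANCE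
FLOOR `δ ≤ c_{A,A}(0; S)` (eventually in `S`, at fixed `β`) plus one short-distance ratio bound
forbids torus-uniform exponential clustering at a given rate.  This file discharges the variance
floor at KERNEL level, for every coupling and every volume, by the one mechanism that is blind to
everything except locality of the action: QUASI-INVARIANCE of the torus Wilson state under a
change of ONE link variable (Literature `integral_comp_edgeTranslate_wilsonMeasure_le`:
multiplying the link `e₀` by `g` costs at most the volume-independent factor `e^{|β| K}`,
`K = K(d, N, ρ)`), followed by the Haar average over `g`, which turns the translated observable
into its one-link Haar variance — a quantity independent of the remaining links whenever `F`
reads `e₀` through a single factor `ρ'(U_{e₀})` inside a trace (right-invariance of Haar).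

* `le_wilsonExpectation_sq_sub_of_oneLink` — torus `(ℤ/L)^d`, any compact second-countable
  `G`, continuous matrix model `ρ`, ANY real `β`, any link `e₀`, any bounded measurable `F`, any
  `c`: if `V ≤ ∫ (F(U with U_{e₀} ↦ U_{e₀} g) - c)² dHaar(g)` for every configuration `U`, then
  `e^{-|β| K} · V ≤ ⟨(F - c)²⟩_{Λ,β}` with `K = 2(d+1)·#{planes}·(N+M)`, `M = sup |Re tr ρ|`.
* `exists_varianceFloor_plaquette` — the summit-native instance: for the plaquette field
  `Re tr ρ'(U_p)` (`plaquetteObservable ρ' _ i j`, `i ≠ j`, any continuous `ρ'`) there is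
  `K = K(ρ) ≥ 0` with, for EVERY `β : ℝ` and EVERY `S ≥ 1`,
  `e^{-K|β|} · Var_{Haar}(Re tr ρ') ≤ latticeConnectedCorr ρ β (2S+1) P.F P.F 0`
  — the time-zero value of the statement's own correlator (the torus variance of the plaquette
  field) is bounded below uniformly in the volume, with an explicit `e^{-K|β|}` dependence.

What this is NOT: anything about decay (IR-1).  It holds verbatim for `U(1)`; it is the
`n = 0` input of the IR-0 alternative (D9's `HasLocalGaussianRatios`, first conjunct), now
unconditional for plaquette fields.  The ratio bound (second conjunct) is the analytic content of
Theorem A of the paper and is not formalised.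

References: E. Seiler, LNP 159 (1982) Ch. 1–2 (bounded local action, Haar a priori measure);
S. Chatterjee, arXiv:1803.01950 §2–3. [folklore mechanism; the summit-native typed statements
are this unit's]
-/

open MeasureTheory
open Literature.MathematicalPhysics.QuantumFieldTheory Literature.MathematicalPhysics.QuantumLattice

noncomputable section

namespace Summit.QuantumFields.YangMills.Theorems.SoloBlind

/-! ### Part 1: the one-link variance floor on the torus `(ℤ/L)^d` -/

section Torus

variable {d L N : ℕ} [NeZero L] {G : Type} [Group G] [TopologicalSpace G] [IsTopologicalGroup G]
  [CompactSpace G] [MeasurableSpace G] [BorelSpace G] [SecondCountableTopology G]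

/-- For a probability measure and an observable with `f` and `f²` integrable:
`∫ (f - c)² = ∫ f² - 2c ∫ f + c²`. [folklore] -/
private theorem integral_sq_sub_const_eq {Ω : Type*} [MeasurableSpace Ω] {ν : Measure Ω}
    [IsProbabilityMeasure ν] {f : Ω → ℝ} (hf : Integrable f ν)
    (hf2 : Integrable (fun ω => f ω ^ 2) ν) (c : ℝ) :
    ∫ ω, (f ω - c) ^ 2 ∂ν = (∫ ω, f ω ^ 2 ∂ν) - 2 * c * (∫ ω, f ω ∂ν) + c ^ 2 := by
  have h1 : Integrable (fun ω => f ω ^ 2 - 2 * c * f ω) ν := hf2.sub (hf.const_mul _)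
  have hpt : (fun ω => (f ω - c) ^ 2) = fun ω => (f ω ^ 2 - 2 * c * f ω) + c ^ 2 := by
    funext ω; ring
  rw [hpt, integral_add h1 (integrable_const _), integral_sub hf2 (hf.const_mul _),
    integral_const_mul, integral_const]
  simp [Measure.real]

/-- **One-link variance floor** (torus `(ℤ/L)^d`, any compact second-countable `G`,
continuous `N × N` matrix model `ρ` with `|Re tr ρ| ≤ M`, ANY real `β`).  Let `e₀` be a link,
`F` a bounded measurable observable and `c, V : ℝ` with
`V ≤ ∫ (F(U_{e₀} ↦ U_{e₀}·g) - c)² dHaar(g)` for every configuration `U`.  Then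
`exp(-|β|·K) · V ≤ ⟨(F - c)²⟩_{Λ,β}`, `K = 2(d+1)·#{planes}·(N+M)`: for each `g`,
quasi-invariance of the Wilson state under `U_{e₀} ↦ U_{e₀} g`
(`integral_comp_edgeTranslate_wilsonMeasure_le`) gives `⟨(F∘T_g - c)²⟩ ≤ e^{|β|K}⟨(F - c)²⟩`;
average over `g` (Fubini) and use the pointwise hypothesis.  Uniform in the volume `L`.
[folklore] -/
theorem le_wilsonExpectation_sq_sub_of_oneLink (ρ : G →* Matrix (Fin N) (Fin N) ℂ)
    (hρ : Continuous ρ) (β : ℝ) {M : ℝ} (hM : ∀ g, |(ρ g).trace.re| ≤ M) (e₀ : Edge d L)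
    {F : GaugeConfig d L G → ℝ} (hFm : Measurable F) {C : ℝ} (hFb : ∀ U, |F U| ≤ C) (c V : ℝ)
    (hV : ∀ U : GaugeConfig d L G,
      V ≤ ∫ g, (F (Function.update U e₀ (U e₀ * g)) - c) ^ 2 ∂(haarProbability G)) :
    Real.exp (-(|β| * (2 * (((d + 1) * Fintype.card {q : Fin d × Fin d // q.1 < q.2} : ℕ) : ℝ) *
        ((N : ℝ) + M)))) * V ≤
      wilsonExpectation ρ β (fun U => (F U - c) ^ 2) := by
  set K : ℝ := 2 * (((d + 1) * Fintype.card {q : Fin d × Fin d // q.1 < q.2} : ℕ) : ℝ) *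
    ((N : ℝ) + M) with hK
  set μ : Measure (GaugeConfig d L G) := wilsonMeasure (d := d) (L := L) ρ β with hμ
  set η : Measure G := haarProbability G with hη
  haveI : IsProbabilityMeasure μ := isProbabilityMeasure_wilsonMeasure (d := d) (L := L) ρ hρ β
  -- the translated integrand, jointly measurable and bounded
  set f : G → GaugeConfig d L G → ℝ := fun g U => (F (Function.update U e₀ (U e₀ * g)) - c) ^ 2
    with hf
  have hbound : ∀ W : GaugeConfig d L G, |(F W - c) ^ 2| ≤ (C + |c|) ^ 2 := fun W => by
    rw [abs_pow]
    refine pow_le_pow_left₀ (abs_nonneg _) ?_ 2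
    calc |F W - c| ≤ |F W| + |c| := abs_sub _ _
      _ ≤ C + |c| := by linarith [hFb W]
  have hupd_meas : Measurable fun p : G × GaugeConfig d L G =>
      Function.update p.2 e₀ (p.2 e₀ * p.1) := by
    refine measurable_pi_lambda _ fun e => ?_
    by_cases he : e = e₀
    · subst he
      simp only [Function.update_self]
      exact ((measurable_pi_apply e).comp measurable_snd).mul measurable_fst
    · simp only [Function.update_of_ne he]
      exact (measurable_pi_apply e).comp measurable_snd
  have hprod : Integrable (Function.uncurry f) (η.prod μ) := by
    have hm : Measurable (Function.uncurry f) :=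
      ((hFm.comp hupd_meas).sub measurable_const).pow_const 2
    refine Integrable.mono' (integrable_const ((C + |c|) ^ 2)) hm.aestronglyMeasurable
      (ae_of_all _ fun p => ?_)
    rw [Real.norm_eq_abs]
    exact hbound _
  have hψi : Integrable (fun U => (F U - c) ^ 2) μ := by
    refine Integrable.mono' (integrable_const ((C + |c|) ^ 2))
      ((hFm.sub measurable_const).pow_const 2).aestronglyMeasurable (ae_of_all _ fun U => ?_)
    rw [Real.norm_eq_abs]
    exact hbound _
  -- quasi-invariance under the right multiplication of the single link `e₀` by `g`
  have hg : ∀ g : G, ∫ U, f g U ∂μ ≤ Real.exp (|β| * K) * ∫ U, (F U - c) ^ 2 ∂μ := by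
    intro g
    have h := integral_comp_edgeTranslate_wilsonMeasure_le (d := d) (L := L) ρ β hM {e₀}
      (fun _ => (1 : G)) (Pi.mulSingle e₀ g⁻¹) (fun _ _ => rfl)
      (fun e he => Pi.mulSingle_eq_of_ne (by simpa using he) _)
      (ψ := fun U => (F U - c) ^ 2) (fun U => sq_nonneg _) hψi
    have hupd : ∀ U : GaugeConfig d L G,
        (fun e => (1 : G) * U e * ((Pi.mulSingle e₀ g⁻¹ : Edge d L → G) e)⁻¹) =
          Function.update U e₀ (U e₀ * g) := by
      intro U; funext e
      by_cases he : e = e₀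
      · subst he; simp
      · simp [Function.update_of_ne he, Pi.mulSingle_eq_of_ne he]
    have hEq : (fun U : GaugeConfig d L G =>
        (F (fun e => (fun _ : Edge d L => (1 : G)) e * U e *
          ((Pi.mulSingle e₀ g⁻¹ : Edge d L → G) e)⁻¹) - c) ^ 2) =
          fun U => f g U := by
      funext U; beta_reduce; rw [hupd U]
    rw [hEq] at h
    simpa [hK, Finset.card_singleton] using h
  -- average over `g`
  have h1 : V ≤ ∫ U, (∫ g, f g U ∂η) ∂μ := by
    have hint : Integrable (fun U => ∫ g, f g U ∂η) μ := hprod.swap.integral_prod_left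
    have := integral_mono (integrable_const V) hint (fun U => hV U)
    simpa [Measure.real] using this
  have h2 : ∫ U, (∫ g, f g U ∂η) ∂μ = ∫ g, (∫ U, f g U ∂μ) ∂η :=
    (integral_integral_swap hprod).symm
  have h3 : ∫ g, (∫ U, f g U ∂μ) ∂η ≤ Real.exp (|β| * K) * ∫ U, (F U - c) ^ 2 ∂μ := by
    have := integral_mono hprod.integral_prod_left (integrable_const _) hg
    simpa [Measure.real] using this
  have hexp : Real.exp (-(|β| * K)) * Real.exp (|β| * K) = 1 := by
    rw [← Real.exp_add]; simp
  calc Real.exp (-(|β| * K)) * V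
      ≤ Real.exp (-(|β| * K)) * (Real.exp (|β| * K) * ∫ U, (F U - c) ^ 2 ∂μ) :=
        mul_le_mul_of_nonneg_left (h1.trans (h2.le.trans h3)) (Real.exp_pos _).le
    _ = ∫ U, (F U - c) ^ 2 ∂μ := by rw [← mul_assoc, hexp, one_mul]
    _ = wilsonExpectation ρ β (fun U => (F U - c) ^ 2) := by simp only [wilsonExpectation, hμ]

end Torus

/-! ### Part 2: the plaquette field of `YangMills`, on the statement's odd tori -/

section Summit

variable {G : Type} [Group G] [TopologicalSpace G] [IsTopologicalGroup G] [CompactSpace G]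
  [MeasurableSpace G] [BorelSpace G] [SecondCountableTopology G]

/-- **Volume-uniform variance floor for the plaquette field** (rung D10).  For every compact
second-countable `G`, continuous action model `ρ`, continuous representation `ρ'` and spatial or
temporal directions `i ≠ j` there is `K = K(ρ) ≥ 0` such that for EVERY `β : ℝ` and EVERY `S ≥ 1`
`exp(-K|β|) · Var_{Haar}(Re tr ρ') ≤ latticeConnectedCorr ρ β (2S+1) P.F P.F 0`,
`P = plaquetteObservable ρ' _ i j`, `Var_{Haar}(f) = ∫ (f - ∫ f dHaar)² dHaar`: the time-zero value of
the statement's correlator — the torus variance of `Re tr ρ'(U_p)` — is bounded below uniformly in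
the volume.  Mechanism: Part 1 with the link `e₀ = (0, i)` of `p`, through which `P` reads a single
factor `ρ'(U_{e₀})` inside the trace, so that the one-link Haar average is `∫ (Re tr ρ'(g k) - c)² dg
= ∫ (Re tr ρ'(g) - c)² dg ≥ Var_{Haar}(Re tr ρ')` by right-invariance of Haar measure. [folklore] -/
theorem exists_varianceFloor_plaquette {N M : ℕ} (ρ : G →* Matrix (Fin N) (Fin N) ℂ)
    (hρ : Continuous ρ) (ρ' : G →* Matrix (Fin M) (Fin M) ℂ) (hρ' : Continuous ρ') {i j : Fin 4}
    (hij : i ≠ j) :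
    ∃ K : ℝ, 0 ≤ K ∧ ∀ (β : ℝ) (S : ℕ), 1 ≤ S →
      Real.exp (-(K * |β|)) *
          (∫ g, ((ρ' g).trace.re - ∫ h, (ρ' h).trace.re ∂(haarProbability G)) ^ 2
            ∂(haarProbability G)) ≤
        latticeConnectedCorr ρ β (2 * S + 1) (plaquetteObservable ρ' hρ' i j).F
          (plaquetteObservable ρ' hρ' i j).F 0 := by
  -- a bound on `Re tr ρ` (continuity on the compact group)
  obtain ⟨Mρ, hMρ⟩ : ∃ Mρ : ℝ, ∀ g : G, |(ρ g).trace.re| ≤ Mρ := by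
    have hc : Continuous fun g : G => (ρ g).trace.re :=
      Complex.continuous_re.comp hρ.matrix_trace
    obtain ⟨B, hB⟩ := isCompact_univ.exists_bound_of_continuousOn hc.continuousOn
    exact ⟨B, fun g => by simpa [Real.norm_eq_abs] using hB g (Set.mem_univ g)⟩
  have hM0 : 0 ≤ Mρ := (abs_nonneg _).trans (hMρ 1)
  set K : ℝ := 2 * (((4 + 1) * Fintype.card {q : Fin 4 × Fin 4 // q.1 < q.2} : ℕ) : ℝ) *
    ((N : ℝ) + Mρ) with hK
  refine ⟨K, by positivity, fun β S hS => ?_⟩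
  haveI : NeZero (2 * S + 1) := ⟨by omega⟩
  haveI : Fact (1 < 2 * S + 1) := ⟨by omega⟩
  set η : Measure G := haarProbability G with hη
  set P : LocalGaugeObservable 4 G := plaquetteObservable ρ' hρ' i j with hP
  -- the torus observable, its measurability and bound
  set A : GaugeConfig 4 (2 * S + 1) G → ℝ := toTorusObservable (2 * S + 1) P.F with hA
  have hAm : Measurable A := P.measurable.comp (measurable_torusLift _)
  obtain ⟨C, hC⟩ := P.bounded
  have hAb : ∀ U, |A U| ≤ C := fun U => hC _
  set μ : Measure (GaugeConfig 4 (2 * S + 1) G) :=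
    wilsonMeasure (d := 4) (L := 2 * S + 1) ρ β with hμ
  haveI : IsProbabilityMeasure μ := isProbabilityMeasure_wilsonMeasure (d := 4) (L := 2 * S + 1) ρ hρ β
  have hAi : Integrable A μ := by
    refine Integrable.mono' (integrable_const C) hAm.aestronglyMeasurable (ae_of_all _ fun U => ?_)
    rw [Real.norm_eq_abs]; exact hAb U
  have hA2i : Integrable (fun U => A U ^ 2) μ := by
    refine Integrable.mono' (integrable_const (C ^ 2)) (hAm.pow_const 2).aestronglyMeasurable
      (ae_of_all _ fun U => ?_)
    rw [Real.norm_eq_abs, abs_pow]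
    exact pow_le_pow_left₀ (abs_nonneg _) (hAb U) 2
  set c : ℝ := ∫ U, A U ∂μ with hc
  -- Step 1: the correlator at `n = 0` is the variance `⟨(A - c)²⟩`
  have hcorr : latticeConnectedCorr ρ β (2 * S + 1) P.F P.F 0 =
      wilsonExpectation ρ β (fun U => (A U - c) ^ 2) := by
    have hcs : ∀ V : LGConfig 4 G, configShift (-Pi.single (0 : Fin 4) ((0 : ℕ) : ℤ)) V = V :=
      fun V => by ext e; simp [configShift_apply]
    rw [latticeConnectedCorr_eq_wilsonExpectation]
    simp only [hcs, wilsonExpectation, toTorusObservable_apply]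
    change (∫ U, A U * A U ∂μ) - (∫ U, A U ∂μ) * (∫ U, A U ∂μ) = ∫ U, (A U - c) ^ 2 ∂μ
    rw [integral_sq_sub_const_eq hAi hA2i c, ← hc]
    have : (fun U => A U * A U) = fun U => A U ^ 2 := by funext U; ring
    rw [this]; ring
  -- Step 2: the one-link Haar average of the translated plaquette field
  set x₀ : Site 4 (2 * S + 1) := Literature.Probability.LatticeModels.Torus.proj (2 * S + 1)
    (0 : Literature.Probability.LatticeModels.Site 4) with hx₀
  set e₀ : Edge 4 (2 * S + 1) := (x₀, i) with he₀
  set fρ : G → ℝ := fun g => (ρ' g).trace.re with hfρ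
  have hfc : Continuous fρ := Complex.continuous_re.comp hρ'.matrix_trace
  obtain ⟨B', hB'⟩ := isCompact_univ.exists_bound_of_continuousOn hfc.continuousOn
  have hfb : ∀ g, |fρ g| ≤ B' := fun g => by simpa [Real.norm_eq_abs] using hB' g (Set.mem_univ g)
  have hfm : Measurable fρ := hfc.measurable
  have hfi : Integrable fρ η := by
    refine Integrable.mono' (integrable_const B') hfm.aestronglyMeasurable (ae_of_all _ fun g => ?_)
    rw [Real.norm_eq_abs]; exact hfb g
  have hf2i : Integrable (fun g => fρ g ^ 2) η := by
    refine Integrable.mono' (integrable_const (B' ^ 2)) (hfm.pow_const 2).aestronglyMeasurable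
      (ae_of_all _ fun g => ?_)
    rw [Real.norm_eq_abs, abs_pow]
    exact pow_le_pow_left₀ (abs_nonneg _) (hfb g) 2
  set m : ℝ := ∫ h, fρ h ∂η with hm
  have hne1 : (x₀.shift i, j) ≠ e₀ := fun h => hij ((Prod.ext_iff.1 h).2).symm
  have hne2 : (x₀.shift j, i) ≠ e₀ := by
    intro h
    have h1 : x₀.shift j = x₀ := (Prod.ext_iff.1 h).1
    have h2 := congr_fun h1 j
    simp [Site.shift] at h2
  have hne3 : (x₀, j) ≠ e₀ := fun h => hij ((Prod.ext_iff.1 h).2).symm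
  have hV : ∀ U : GaugeConfig 4 (2 * S + 1) G,
      ∫ g, (fρ g - m) ^ 2 ∂η ≤ ∫ g, (A (Function.update U e₀ (U e₀ * g)) - c) ^ 2 ∂η := by
    intro U
    set k : G := U (x₀.shift i, j) * (U (x₀.shift j, i))⁻¹ * (U (x₀, j))⁻¹ * U e₀ with hk
    have hval : ∀ g : G, A (Function.update U e₀ (U e₀ * g)) = fρ (g * k) := by
      intro g
      simp only [hA, hP, toTorusObservable_apply, plaquetteObservable_F, plaquetteObs,
        FreeEnergy.plaquetteHolonomyZd_torusLift, plaquetteHolonomy, hfρ]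
      rw [show Literature.Probability.LatticeModels.Torus.proj (2 * S + 1)
            (0 : Literature.Probability.LatticeModels.Site 4) = x₀ from rfl,
        show ((x₀, i) : Edge 4 (2 * S + 1)) = e₀ from rfl, Function.update_self,
        Function.update_of_ne hne1, Function.update_of_ne hne2, Function.update_of_ne hne3]
      have hgrp : U e₀ * g * U (x₀.shift i, j) * (U (x₀.shift j, i))⁻¹ * (U (x₀, j))⁻¹ =
          U e₀ * (g * (U (x₀.shift i, j) * (U (x₀.shift j, i))⁻¹ * (U (x₀, j))⁻¹)) := by
        simp only [mul_assoc]
      rw [hgrp, map_mul, Matrix.trace_mul_comm, ← map_mul, hk]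
      simp only [mul_assoc]
    simp only [hval]
    have hmp : MeasurePreserving (fun x : G => x * k) η η := by
      have h := measurePreserving_mul_mul_inv_haarProbability (G := G) 1 k⁻¹
      simp only [one_mul, inv_inv] at h
      exact h
    have hci : ∫ g, (fρ (g * k) - c) ^ 2 ∂η = ∫ g, (fρ g - c) ^ 2 ∂η :=
      hmp.integral_comp (measurableEmbedding_mulRight k) (fun x : G => (fρ x - c) ^ 2)
    rw [hci, integral_sq_sub_const_eq hfi hf2i c, integral_sq_sub_const_eq hfi hf2i m, ← hm]
    nlinarith [sq_nonneg (m - c)]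
  -- Step 3: Part 1
  have h := le_wilsonExpectation_sq_sub_of_oneLink (d := 4) (L := 2 * S + 1) ρ hρ β hMρ e₀ hAm hAb
    c (∫ g, (fρ g - m) ^ 2 ∂η) hV
  rw [hcorr, mul_comm K |β|]
  simpa [hK, hfρ, hm, hη] using h

end Summit

end Summit.QuantumFields.YangMills.Theorems.SoloBlind

end
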